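import Summits.Parity.GeneralizedHardyLittlewood.Theorems.PrimeLevelFamEdgeMomentsBeyondDiagonalDiagDivisorPairsMoebius
import Summits.Parity.GeneralizedHardyLittlewood.Theorems.BeyondDiagonalBeatsQuarter.CornerReduction
import HarnessLib

/-!
# Route `PrimeLevelFamEdge`, crux K_A `MomentsBeyondDiagonal` (stmt-Parity-20007), line «petersson_layers» v4, stub `stub_diag`:
# **the decorated Selberg reindexing of a diagonal quadratic form with factorisation-dependent weights (census R3(ii), third brick)**

K_B's `Corner.quadForm_hKernel_eq` (`CornerReduction`) diagonalises `Σ_{a,b≤N} x_a x_b K_h(a,b)` for kernels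
`K_h(a,b) = (ab)⁻¹Σ_{c∣(a,b)} c·τ(K)·h(K)`, `K = (a/c)(b/c)`, whose weight sees only the PRODUCT `K = n₁n₂` of the two AFE
variables. At a general even-or-odd `Q` the diagonal weight depends on the ordered factorisation `(n₁, n₂)` itself (the
log-decorations `(ℓ − log n_ν)^α` of `…DiagLineSeries`), i.e. `τ(K)h(K)` becomes `Σ_{n₁n₂ = K} h(n₁,n₂)`. With the weighted
τ-decoupling `…DiagDivisorPairsMoebius.sum_divisors_mul_eq_sum_moebius` the same reindexing goes through:

* `quadForm_decorated_eq` — **for ANY coefficients `x` and ANY two-variable weight `h`,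
  `Σ_{a,b≤N} x_a x_b (ab)⁻¹ Σ_{c∣(a,b)} c Σ_{n₁n₂=(a/c)(b/c)} h(n₁,n₂)
   = Σ_{c≤N} Σ_{g≤N/c} μ(g)·c·Σ_{k₁,k₂≤N/(cg)} (x_{cgk₁}/(cgk₁))(x_{cgk₂}/(cgk₂))·Σ_{d∣k₁}Σ_{e∣k₂} h((k₁/d)·ge, gd·(k₂/e))`**
  (`h(n₁,n₂) = H(n₁n₂)` recovers `quadForm_hKernel_eq` since `Σ_{d∣k₁}Σ_{e∣k₂}1 = τ(k₁)τ(k₂)` and `n₁n₂ = g²k₁k₂`).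
For `h(n₁,n₂) = (log n₁)^α(log n₂)^β·H(n₁n₂)` the inner divisor sums are products of the generalised divisor sums
`Σ_{d∣k}(log d)^i(log(k/d))^j` in `k₁` and in `k₂` separately (multinomial expansion of `log(k₁/d) + log g + log e` etc.) —
the decorated Selberg coordinates of the general-`Q` diagonal.

Def-free; theorems only. Helper `--supports stmt-Parity-20007`; closes nothing; K_A, K_B and the Parity summit are NOT
proved; nothing about Landau–Siegel zeros.

## References
* E. Kowalski, P. Michel, J. VanderKam, J. reine angew. Math. 526 (2000), (21)–(23) pp. 12–13 and Prop. 5.1 p. 18.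
  [cite: KowalskiMichelVanderKam2000, (21)–(23) — derivation (Selberg-type coordinates, factorisation-dependent weights)]
-/

noncomputable section

open Finset ArithmeticFunction
open scoped ArithmeticFunction.Moebius

namespace Summit.Parity.GeneralizedHardyLittlewood.Theorems.MomentsBeyondDiagonal.DiagLines

open Summit.Parity.GeneralizedHardyLittlewood.Theorems.BeyondDiagonalBeatsQuarter.Corner (sum_sum_sum_gcd_divisors_eq)

/-- **The decorated Selberg reindexing.** For every coefficient vector `x`, every two-variable weight `h` and every `N`:
`Σ_{a,b≤N} x_a x_b·(ab)⁻¹Σ_{c∣(a,b)} c·Σ_{D∣(a/c)(b/c)} h(D, (a/c)(b/c)/D)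
 = Σ_{c≤N} Σ_{g≤N/c} μ(g)·c·Σ_{k₁,k₂≤N/(cg)} (x_{cgk₁}/(cgk₁))·(x_{cgk₂}/(cgk₂))·Σ_{d∣k₁}Σ_{e∣k₂} h((k₁/d)(ge), (gd)(k₂/e))`
(substitute `a = cu`, `b = cv`; decouple `Σ_{D∣uv}` by Möbius; substitute `u = gk₁`, `v = gk₂`).
[cite: KowalskiMichelVanderKam2000, (21)–(23) and Prop. 5.1 — derivation (Selberg-type coordinates for a factorisation-dependent cut-off)] -/
theorem quadForm_decorated_eq (x : ℕ → ℝ) (h : ℕ → ℕ → ℝ) (N : ℕ) :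
    ∑ a ∈ Icc 1 N, ∑ b ∈ Icc 1 N, x a * x b *
        ((∑ c ∈ (Nat.gcd a b).divisors, (c : ℝ) *
            ∑ D ∈ (a / c * (b / c)).divisors, h D (a / c * (b / c) / D)) / ((a : ℝ) * b)) =
      ∑ c ∈ Icc 1 N, ∑ g ∈ Icc 1 (N / c), (μ g : ℝ) * c *
        ∑ k₁ ∈ Icc 1 (N / (c * g)), ∑ k₂ ∈ Icc 1 (N / (c * g)),
          (x (c * g * k₁) / ((c * g * k₁ : ℕ) : ℝ)) * (x (c * g * k₂) / ((c * g * k₂ : ℕ) : ℝ)) *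
            ∑ d ∈ k₁.divisors, ∑ e ∈ k₂.divisors, h (k₁ / d * (g * e)) (g * d * (k₂ / e)) := by
  -- Step 1: pull the divisor sum out and substitute a = cu, b = cv
  have step1 : ∑ a ∈ Icc 1 N, ∑ b ∈ Icc 1 N, x a * x b *
      ((∑ c ∈ (Nat.gcd a b).divisors, (c : ℝ) *
          ∑ D ∈ (a / c * (b / c)).divisors, h D (a / c * (b / c) / D)) / ((a : ℝ) * b)) =
      ∑ a ∈ Icc 1 N, ∑ b ∈ Icc 1 N, ∑ c ∈ (Nat.gcd a b).divisors,
        x a * x b * ((c : ℝ) * ∑ D ∈ (a / c * (b / c)).divisors, h D (a / c * (b / c) / D)) / ((a : ℝ) * b) := by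
    refine Finset.sum_congr rfl fun a _ ↦ Finset.sum_congr rfl fun b _ ↦ ?_
    rw [Finset.sum_div, Finset.mul_sum]
    exact Finset.sum_congr rfl fun c _ ↦ by ring
  rw [step1, sum_sum_sum_gcd_divisors_eq]
  refine Finset.sum_congr rfl fun c hc ↦ ?_
  have hc0 : c ≠ 0 := by have := (Finset.mem_Icc.1 hc).1; omega
  have hcR : (c : ℝ) ≠ 0 := by exact_mod_cast hc0
  -- Step 2: (cu)/c = u, (cv)/c = v
  have step2 : ∀ u ∈ Icc 1 (N / c), ∀ v ∈ Icc 1 (N / c),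
      x (c * u) * x (c * v) * ((c : ℝ) * ∑ D ∈ (c * u / c * (c * v / c)).divisors,
        h D (c * u / c * (c * v / c) / D)) / (((c * u : ℕ) : ℝ) * ((c * v : ℕ) : ℝ)) =
      (c : ℝ)⁻¹ * ((x (c * u) / u) * (x (c * v) / v)) * ∑ D ∈ (u * v).divisors, h D (u * v / D) := by
    intro u hu v hv
    have hu0 : (u : ℝ) ≠ 0 := by have := (Finset.mem_Icc.1 hu).1; positivity
    have hv0 : (v : ℝ) ≠ 0 := by have := (Finset.mem_Icc.1 hv).1; positivity
    rw [Nat.mul_div_cancel_left u (Nat.pos_of_ne_zero hc0),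
      Nat.mul_div_cancel_left v (Nat.pos_of_ne_zero hc0)]
    push_cast
    field_simp
  rw [Finset.sum_congr rfl fun u hu ↦ Finset.sum_congr rfl fun v hv ↦ step2 u hu v hv]
  -- Step 3: decouple `Σ_{D ∣ uv}` by Möbius and substitute u = gk₁, v = gk₂
  have step3 : ∀ u ∈ Icc 1 (N / c), ∀ v ∈ Icc 1 (N / c),
      (c : ℝ)⁻¹ * ((x (c * u) / u) * (x (c * v) / v)) * ∑ D ∈ (u * v).divisors, h D (u * v / D) =
      ∑ g ∈ (Nat.gcd u v).divisors, (c : ℝ)⁻¹ * ((x (c * u) / u) * (x (c * v) / v)) *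
        ((μ g : ℝ) * ∑ d ∈ (u / g).divisors, ∑ e ∈ (v / g).divisors,
          h (u / (g * d) * (g * e)) (g * d * (v / (g * e)))) := by
    intro u hu v hv
    have hu0 : u ≠ 0 := by have := (Finset.mem_Icc.1 hu).1; omega
    have hv0 : v ≠ 0 := by have := (Finset.mem_Icc.1 hv).1; omega
    rw [sum_divisors_mul_eq_sum_moebius hu0 hv0 h, Finset.mul_sum]
    refine Finset.sum_congr rfl fun g _ ↦ ?_
    rw [zsmul_eq_mul]
  rw [Finset.sum_congr rfl fun u hu ↦ Finset.sum_congr rfl fun v hv ↦ step3 u hu v hv,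
    sum_sum_sum_gcd_divisors_eq (N / c)]
  refine Finset.sum_congr rfl fun g hg ↦ ?_
  have hg0 : g ≠ 0 := by have := (Finset.mem_Icc.1 hg).1; omega
  have hgpos : 0 < g := Nat.pos_of_ne_zero hg0
  have hgR : (g : ℝ) ≠ 0 := by exact_mod_cast hg0
  rw [Nat.div_div_eq_div_mul, Finset.mul_sum]
  refine Finset.sum_congr rfl fun k₁ hk₁ ↦ ?_
  rw [Finset.mul_sum]
  refine Finset.sum_congr rfl fun k₂ hk₂ ↦ ?_
  have hk₁0 : (k₁ : ℝ) ≠ 0 := by have := (Finset.mem_Icc.1 hk₁).1; positivity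
  have hk₂0 : (k₂ : ℝ) ≠ 0 := by have := (Finset.mem_Icc.1 hk₂).1; positivity
  rw [Nat.mul_div_cancel_left k₁ hgpos, Nat.mul_div_cancel_left k₂ hgpos]
  -- the inner divisor sums agree termwise: (gk₁)/(gd) = k₁/d, (gk₂)/(ge) = k₂/e
  have hinner : ∑ d ∈ k₁.divisors, ∑ e ∈ k₂.divisors,
      h (g * k₁ / (g * d) * (g * e)) (g * d * (g * k₂ / (g * e))) =
      ∑ d ∈ k₁.divisors, ∑ e ∈ k₂.divisors, h (k₁ / d * (g * e)) (g * d * (k₂ / e)) := by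
    refine Finset.sum_congr rfl fun d _ ↦ Finset.sum_congr rfl fun e _ ↦ ?_
    rw [Nat.mul_div_mul_left k₁ d hgpos, Nat.mul_div_mul_left k₂ e hgpos]
  rw [hinner, show c * (g * k₁) = c * g * k₁ by ring, show c * (g * k₂) = c * g * k₂ by ring]
  push_cast
  field_simp

end Summit.Parity.GeneralizedHardyLittlewood.Theorems.MomentsBeyondDiagonal.DiagLines

end
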